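import Literature.NumberTheory.ComplexMultiplication.EllipticUnits.KatoLayerArtinCompatibility
import Literature.NumberTheory.NumberFields.RayClassFieldsOfRat
import Literature.NumberTheory.NumberFields.UnramifiedCompositum
import HarnessLib

/-!
# Kato's ray-class tower `K(p^s𝔣)`: it is unramified outside `supp(p𝔣)` (the ramification subgroup
# `N_{supp(p𝔣)}` fixes every layer) and, over a totally complex `K`, it contains the `p^s`-th roots of unity

Topic `NumberTheory/ComplexMultiplication/EllipticUnits`; namespace
`Literature.NumberTheory.ComplexMultiplication.EllipticUnits`. Cell `bsd-print-cf2`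
(`run/shared/lean/pub/bsd-print-cf2/`), width seat `bsd-line-cf2-p1-w2` g17, `--supports` the deciding
child stmt-BirchSwinnertonDyer-24721 of crux 20368. THEOREMS ONLY (no `def`, no named fact, no `sorry`).
Third file on Kato's tower after `KatoLayerArtinCompatibility.lean` / `KatoLayerArtinExponents.lean`: the
two SLACK LEMMAS that the zeta pin (Z1) of Johnson-Leung–Kings' `TwistedIwasawaData` presupposes
(tree `ImaginaryQuadraticMainConjectureCarriers.lean`, transcription note (T4): "for `s ≥ k + 2` the
12th-root ambiguity of the representative is a `p^k`-th power in `K(p^s𝔣)` and does not change the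
cocycle"; the twisted Kummer class lives on `G_S(K(p^s𝔣))`, `S = supp(p𝔣)`):

* §1 `mem_suppPF_of_katoModulus_le` (a prime containing `p^s𝔣` divides `p𝔣`) and
  **`ramificationSubgroup_suppPF_le_katoLevelSubgroup`**: `N_{supp(p𝔣)} ≤ Gal(K̄/K(p^s𝔣))` for every `s`
  — the ray class field `K(p^s𝔣)` is unramified outside the support of its modulus (Neukirch VI (6.2)/(6.6),
  the tree's `isUnramifiedIn_rayClassField` + `ramificationSubgroup_le_ker`);
* §2 for TOTALLY COMPLEX `K` (no real place, so Neukirch's `K^𝔪` is the tree's `rayClassField`,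
  `rayClassField_eq_narrowRayClassField`): **`adjoin_rootsOfUnity_le_katoLayer`** `K(μ_{p^s}) ⊆ K(p^s𝔣)`
  (Neukirch VI (6.7) proof: `(m)` is a module of definition of `K(ζ_m)|K`, the tree's
  `le_narrowRayClassField_of_isCyclotomicExtension`, and `(p^s) ∣ p^s𝔣`), `mem_katoLayer_of_pow_eq_one(_of_le)`
  and the Galois form **`smul_eq_self_of_mem_katoLevelSubgroup_of_pow_eq_one`**: `Gal(K̄/K(p^s𝔣))` fixes
  `μ_{p^k}` for `k ≤ s`.

HONEST FRAMING: class-field-theoretic bookkeeping on Kato's tower; nothing here is about an elliptic curve;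
BSD is not advanced.

## References
* [Kato2004Asterisque] K. Kato, Astérisque 295 (2004), §15.1 (p. 250), §15.5 (p. 253: the `p`-units of
  `K(p^s𝔣)`, `_𝔞θ_E(α)` up to 12th roots of unity).
* [JohnsonLeungKings2011] J. Johnson-Leung, G. Kings, J. reine angew. Math. 653 (2011), Def. 3.2, §3.3
  (arXiv:0804.2828 p0009:L55–70, p0010:L55–80: the Kummer class on `𝒪_{K(p^s𝔣)}[1/S]`).
* [NeukirchANT1999] J. Neukirch, *Algebraic Number Theory* (1999), Ch. VI §6 Def. (6.2), Cor. (6.6),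
  Prop. (6.7) (proof, p. 399).
-/

noncomputable section

open scoped Classical
open Field NumberField IsDedekindDomain
open Literature.NumberTheory.NumberFields (rayClassField rayUnitIdeles rayClassField_mono isUnramifiedIn_rayClassField
  le_narrowRayClassField_of_isCyclotomicExtension rayClassField_eq_narrowRayClassField
  isCyclotomicExtension_adjoin_setOf_pow_eq_one isUnramifiedIn_iff_forall_inertia_absRestrictNormalHom_eq_one)
open Literature.NumberTheory.GaloisRepresentations
open Literature.NumberTheory.EllipticCurves

namespace Literature.NumberTheory.ComplexMultiplication.EllipticUnits

variable {K : Type} [Field K] [NumberField K] (p : ℕ) (𝔣 : Ideal (𝓞 K))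

/-! ## §1. `K(p^s𝔣)` is unramified outside `supp(p𝔣)` -/

/-- A prime `𝔮 ⊇ p^s𝔣` divides `p𝔣`, i.e. lies in `supp(p𝔣)`. [cite: JohnsonLeungKings2011, Cor. 5.3 (arXiv p0015:L1–3)] -/
theorem mem_suppPF_of_katoModulus_le [Fact p.Prime] {v : HeightOneSpectrum (𝓞 K)} {s : ℕ}
    (h : katoModulus p 𝔣 s ≤ v.asIdeal) : v ∈ JohnsonLeungKings2011.suppPF p 𝔣 := by
  haveI := v.isPrime
  change v.asIdeal ∣ Ideal.span {((p : ℕ) : 𝓞 K)} * 𝔣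
  rw [Ideal.dvd_iff_le]
  rw [katoModulus] at h
  rcases v.isPrime.mul_le.mp h with h | h
  · exact Ideal.mul_le_right.trans (Ideal.IsPrime.le_of_pow_le h)
  · exact Ideal.mul_le_left.trans h

/-- **`N_{supp(p𝔣)} ≤ Gal(K̄/K(p^s𝔣))` for every `s`**: the ramification subgroup outside `supp(p𝔣)`
(generated by the inertia groups at the places `𝔮 ∤ p𝔣`) fixes every layer of Kato's tower — the ray class
field `K(p^s𝔣)` is unramified at every `𝔮 ∤ p^s𝔣`. So the layer groups are open subgroups of `Γ_K`
containing `N_S`, `S = supp(p𝔣)`: the levels of `G_S(K)`-cohomology on which JLK's classes live.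
[cite: NeukirchANT1999, Ch. VI §6 Def. (6.2) and Cor. (6.6)] [cite: JohnsonLeungKings2011, Def. 3.2 (arXiv p0009:L55–70)] -/
theorem ramificationSubgroup_suppPF_le_katoLevelSubgroup [Fact p.Prime] (h𝔣 : 𝔣 ≠ ⊥) (s : ℕ) :
    ramificationSubgroup K (JohnsonLeungKings2011.suppPF p 𝔣) ≤ JohnsonLeungKings2011.katoLevelSubgroup p 𝔣 s :=
  ramificationSubgroup_le_ker (absRestrictNormalHom (katoLayer p 𝔣 s)) (isOpen_ker_absRestrictNormalHom _)
    fun v hv 𝔓 h𝔓 σ hσ ↦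
      (isUnramifiedIn_iff_forall_inertia_absRestrictNormalHom_eq_one (katoLayer p 𝔣 s) v).mp
        (isUnramifiedIn_rayClassField (katoModulus_ne_bot p 𝔣 h𝔣 s)
          fun hle ↦ hv (mem_suppPF_of_katoModulus_le p 𝔣 hle)) 𝔓 h𝔓 σ hσ

/-! ## §2. Totally complex `K`: `μ_{p^s} ⊂ K(p^s𝔣)` -/

omit [NumberField K] in
/-- `(p^s) = (p)^s` as ideals of `𝓞 K`. [cite: Kato2004Asterisque, §15.1 (p. 250)] -/
theorem span_natCast_pow_eq (s : ℕ) :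
    (Ideal.span {((p ^ s : ℕ) : 𝓞 K)} : Ideal (𝓞 K)) = Ideal.span {((p : ℕ) : 𝓞 K)} ^ s := by
  rw [Nat.cast_pow, Ideal.span_singleton_pow]

omit [NumberField K] in
/-- `p^s𝔣 ⊆ (p^s)`. [cite: Kato2004Asterisque, §15.1 (p. 250)] -/
theorem katoModulus_le_span_natCast_pow (s : ℕ) :
    katoModulus p 𝔣 s ≤ Ideal.span {((p ^ s : ℕ) : 𝓞 K)} := by
  rw [span_natCast_pow_eq]
  exact katoModulus_le_span_pow p 𝔣 s

/-- **`K(μ_{p^s}) ⊆ K(p^s𝔣)` over a totally complex `K`**: `(p^s)` is a module of definition of the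
cyclotomic extension `K(ζ_{p^s})|K` (Neukirch VI (6.7), proof), Neukirch's `K^{(p^s)}` is the tree's
`rayClassField` when `K` has no real place, and `C_{(p^s)} ⊆ C_{p^s𝔣}`.
[cite: NeukirchANT1999, Ch. VI §6 Prop. (6.7) (proof) p. 399] [cite: Kato2004Asterisque, §15.5 (p. 253)] -/
theorem adjoin_rootsOfUnity_le_katoLayer [IsTotallyComplex K] [Fact p.Prime] (h𝔣 : 𝔣 ≠ ⊥) (s : ℕ) :
    IntermediateField.adjoin K {ζ : AlgebraicClosure K | ζ ^ (p ^ s) = 1} ≤ katoLayer p 𝔣 s := by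
  haveI : NeZero (p ^ s) := ⟨pow_ne_zero _ (Fact.out : p.Prime).ne_zero⟩
  haveI := isCyclotomicExtension_adjoin_setOf_pow_eq_one (K := K) (p ^ s)
  have h𝔪 : (Ideal.span {((p ^ s : ℕ) : 𝓞 K)} : Ideal (𝓞 K)) ≠ ⊥ := by
    rw [span_natCast_pow_eq]
    exact pow_ne_zero _ (span_natCast_prime_ne_bot p)
  have h1 := le_narrowRayClassField_of_isCyclotomicExtension (K := K) (p ^ s)
    (IntermediateField.adjoin K {ζ : AlgebraicClosure K | ζ ^ (p ^ s) = 1}) h𝔪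
  rw [← rayClassField_eq_narrowRayClassField h𝔪] at h1
  exact h1.trans (rayClassField_mono
    (rayUnitIdeles_anti_of_le (katoModulus_ne_bot p 𝔣 h𝔣 s) (katoModulus_le_span_natCast_pow p 𝔣 s)))

/-- **`μ_{p^s} ⊂ K(p^s𝔣)`** (totally complex `K`). [cite: NeukirchANT1999, Ch. VI §6 Prop. (6.7) (proof) p. 399]
[cite: Kato2004Asterisque, §15.5 (p. 253)] -/
theorem mem_katoLayer_of_pow_eq_one [IsTotallyComplex K] [Fact p.Prime] (h𝔣 : 𝔣 ≠ ⊥) {s : ℕ}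
    {ζ : AlgebraicClosure K} (hζ : ζ ^ (p ^ s) = 1) : ζ ∈ katoLayer p 𝔣 s :=
  adjoin_rootsOfUnity_le_katoLayer p 𝔣 h𝔣 s (IntermediateField.subset_adjoin K _ hζ)

/-- **`μ_{p^k} ⊂ K(p^s𝔣)` for `k ≤ s`** (totally complex `K`) — the slack used by the zeta pin: for
`s ≥ k + 2`, `μ_{p^{k+2}} ⊂ K(p^s𝔣)`. [cite: Kato2004Asterisque, §15.5 (p. 253)]
[cite: JohnsonLeungKings2011, §3.3 and Def. 3.5 (arXiv p0010:L55–80)] -/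
theorem mem_katoLayer_of_pow_eq_one_of_le [IsTotallyComplex K] [Fact p.Prime] (h𝔣 : 𝔣 ≠ ⊥) {k s : ℕ}
    (hks : k ≤ s) {ζ : AlgebraicClosure K} (hζ : ζ ^ (p ^ k) = 1) : ζ ∈ katoLayer p 𝔣 s :=
  katoLayer_mono p 𝔣 h𝔣 hks (mem_katoLayer_of_pow_eq_one p 𝔣 h𝔣 hζ)

/-- **`Gal(K̄/K(p^s𝔣))` fixes `μ_{p^k}` for `k ≤ s`** (totally complex `K`), Galois form of the slack.
[cite: Kato2004Asterisque, §15.5 (p. 253)] [cite: JohnsonLeungKings2011, §3.3 and Def. 3.5 (arXiv p0010:L55–80)] -/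
theorem smul_eq_self_of_mem_katoLevelSubgroup_of_pow_eq_one [IsTotallyComplex K] [Fact p.Prime]
    (h𝔣 : 𝔣 ≠ ⊥) {k s : ℕ} (hks : k ≤ s) {τ : absoluteGaloisGroup K}
    (hτ : τ ∈ JohnsonLeungKings2011.katoLevelSubgroup p 𝔣 s) {ζ : AlgebraicClosure K} (hζ : ζ ^ (p ^ k) = 1) :
    τ • ζ = ζ :=
  (mem_absGaloisFixingSubgroup_iff (katoLayer p 𝔣 s) τ).mp hτ ζ
    (mem_katoLayer_of_pow_eq_one_of_le p 𝔣 h𝔣 hks hζ)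

/-- The same for units of `K̄` (the currency of the tree's `smul_units_eq_self_of_mem_ramificationSubgroup`).
[cite: Kato2004Asterisque, §15.5 (p. 253)] -/
theorem smul_units_eq_self_of_mem_katoLevelSubgroup_of_pow_eq_one [IsTotallyComplex K] [Fact p.Prime]
    (h𝔣 : 𝔣 ≠ ⊥) {k s : ℕ} (hks : k ≤ s) {τ : absoluteGaloisGroup K}
    (hτ : τ ∈ JohnsonLeungKings2011.katoLevelSubgroup p 𝔣 s) (ζ : (AlgebraicClosure K)ˣ) (hζ : ζ ^ (p ^ k) = 1) :
    τ • (ζ : AlgebraicClosure K) = ζ :=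
  smul_eq_self_of_mem_katoLevelSubgroup_of_pow_eq_one p 𝔣 h𝔣 hks hτ
    (by rw [← Units.val_pow_eq_pow_val, hζ, Units.val_one])

end Literature.NumberTheory.ComplexMultiplication.EllipticUnits
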